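import Summits.Ventures.CertifiedManyBodySolver.Observables.StiffnessTLOddMomentCeiling
import Literature.MathematicalPhysics.QuantumLattice.FermionTorusTranslationSums
import Literature.MathematicalPhysics.QuantumLattice.HubbardWindowCertificate
import HarnessLib

/-!
# Ventures/CertifiedManyBodySolver — Observables: the LOCAL OBSERVABLES of the odd-moment (Krylov-3)
# stiffness row `R-K3-TL` and the translation-sum representations of `𝒦`, `𝒥`, `[H,𝒥]`, `[H,[H,𝒥]]`

HONEST FRAMING: one-sided CEILINGS on the flux stiffness (helicity modulus / superfluid weight); not
a superconductivity verdict; no stiffness floor follows from equal-time data and an energy window.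

Cell `hubbard-obs` (D-0042), seat p2 (stiffness). First half of the discharge of the IDENTIFICATION
hypothesis `hId` of the `R-K3-TL` adapter `fluxStiffness_le_of_torusLimit_oddMoment_row`
(`StiffnessTLOddMomentCeiling.lean`); the second half is `StiffnessTLOddMomentIdentification.lean`.
No word expansion enters the kernel: all objects are LOCAL COMMUTATORS.

* `kinBondObs = k₀ = Σ_σ (c†_{e₁σ}c_{0σ} + h.c.)`, `curBondObs = j₀ = Σ_σ (−i c†_{e₁σ}c_{0σ} + i c†_{0σ}c_{e₁σ})`
  in `𝔄_{[-1,1]²}`; `kinOpTT' L 0 = Σ_v T_v Γ(k₀)`, `curOpTT' L 0 = Σ_v T_v Γ(j₀)`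
  (`kinOpTT'_zero_eq_sum_translate`, `curOpTT'_zero_eq_sum_translate`).
* `curDerivObs U = b₀ = [H_{[-2,2]²}, j₀]`, `curDeriv2Obs U = c₀ = [H_{[-3,3]²}, b₀]` (free-boundary Hubbard
  Hamiltonians, `t = 1`): `H𝒥 − 𝒥H = Σ_v T_v Γ(b₀)` (`L ≥ 7`) and `H B − B H = Σ_v T_v Γ(c₀)`, `B = H𝒥 − 𝒥H`
  (`L ≥ 9`) — graded locality, `hubbardTorus_commutator_sum_relabel_translate`.
* `firstMomentObs U = d₁ = Σ_{z∈[-3,3]²}[τ_z j₀, b₀] ∈ 𝔄_{[-4,4]²}` and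
  `thirdMomentObs U = m₃' = Σ_{z∈[-5,5]²}[τ_z b₀, c₀] ∈ 𝔄_{[-7,7]²}` (`commDensity`): the local densities of
  `[𝒥,[H,𝒥]]` and `[B,[H,B]]`; `oddMomentLimitFunctional U λ ω = ½Re ω(k₀) + λ Re ω(d₁) − (λ²/2) Re ω(m₃')`.
* evenness of `j₀`, `b₀`, of the local Hamiltonians; `Bᴴ = −B`; and the elementary
  `Re⟨ψ, XYψ⟩ = ½Re⟨ψ,(XY − YX)ψ⟩` when `(XY)⋆ = −YX`.

For the cell's bookkeeping: `Re ω(d₁) = 2m₁/site = 2U·ω(d1U)` and `Re ω(m₃') = −2m₃/site =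
−2(U²ω(m3T) + U³ω(m3U))` in the word densities of `HOME/hubbard-obs-p2/ops/tl/README.md` (the hopping parts
of the local commutators have translation sums `[T,𝒥] = 0`, hence vanish in translation-invariant states);
that word match is the usual two-lineage objective-provenance leg, outside the kernel.

References: [ScalapinoWhiteZhang1993] §II; [HazraVermaRanderia2019] eq. (4); [Lipparini2008] eq. (8.30);
[BratteliRobinsonII1997] §5.2.2, §6.2.1, Thm. 6.2.4.
-/

noncomputable section

namespace Summit.Ventures.CertifiedManyBodySolver.Observables

open Matrix Finset Filter Topology
open Literature.MathematicalPhysics.QuantumLattice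
open Literature.MathematicalPhysics.QuantumLattice.ThermodynamicLimit
open Literature.MathematicalPhysics.QuantumFieldTheory
open Literature.Probability.LatticeModels
open scoped ComplexOrder ComplexConjugate Topology

/-! ### Boxes of `ℤ²` used by the local observables -/

/-- `0 ∈ [-1,1]²`. [folklore] -/
theorem zero_mem_box_one : (0 : Site 2) ∈ box 2 1 := zero_mem_box 2 1

/-- `e₁ ∈ [-1,1]²`. [folklore] -/
theorem unitVec_zero_mem_box_one : (unitVec 0 : Site 2) ∈ box 2 1 := by
  rw [mem_box]
  intro i
  fin_cases i <;> simp

/-- `[-M,M]^d ⊆ [-N,N]^d` for `M ≤ N`. [folklore] -/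
theorem box_subset_box {d M N : ℕ} (h : M ≤ N) : box d M ⊆ box d N := box_mono d h

/-- `x ± e_i ∈ [-(M+1), M+1]^d` for `x ∈ [-M,M]^d`. [folklore] -/
theorem add_sub_unitVec_mem_box_succ {d M : ℕ} {x : Site d} (hx : x ∈ box d M) (i : Fin d) :
    x + unitVec i ∈ box d (M + 1) ∧ x - unitVec i ∈ box d (M + 1) := by
  rw [mem_box] at hx
  constructor
  · rw [mem_box]
    intro j
    have h := hx j
    by_cases hji : j = i
    · subst hji; simp only [Pi.add_apply, Pi.single_eq_same, Nat.cast_add, Nat.cast_one]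
      constructor <;> linarith [h.1, h.2]
    · simp only [Pi.add_apply, Pi.single_eq_of_ne hji, add_zero, Nat.cast_add, Nat.cast_one]
      constructor <;> linarith [h.1, h.2]
  · rw [mem_box]
    intro j
    have h := hx j
    by_cases hji : j = i
    · subst hji; simp only [Pi.sub_apply, Pi.single_eq_same, Nat.cast_add, Nat.cast_one]
      constructor <;> linarith [h.1, h.2]
    · simp only [Pi.sub_apply, Pi.single_eq_of_ne hji, sub_zero, Nat.cast_add, Nat.cast_one]
      constructor <;> linarith [h.1, h.2]

/-- `thicken [-M,M]^d 1 ⊆ [-(M+1), M+1]^d`. [folklore] -/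
theorem thicken_box_one_subset (d M : ℕ) : thicken (box d M) 1 ⊆ box d (M + 1) := by
  intro x hx
  simp only [thicken, Nat.floor_one, Finset.mem_biUnion, Finset.mem_image] at hx
  obtain ⟨y, hy, v, hv, rfl⟩ := hx
  rw [mem_box] at hy hv ⊢
  intro i
  have h1 := hy i
  have h2 := hv i
  simp only [Pi.add_apply, Nat.cast_add, Nat.cast_one] at h2 ⊢
  constructor <;> linarith [h1.1, h1.2, h2.1, h2.2]

/-- `x ↦ x mod L` is injective on `thicken [-M,M]^d 1` once `2M + 2 < L`. [cite: FriedliVelenik2017, §3.1] -/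
theorem injOn_proj_thicken_box_one {d M L : ℕ} (hL : 2 * (M + 1) < L) :
    Set.InjOn (Torus.proj (d := d) L) ↑(thicken (box d M) 1) :=
  (injOn_proj_box hL).mono (Finset.coe_subset.2 (thicken_box_one_subset d M))

/-! ### The local observables of the row -/

/-- The **`e₁`-bond kinetic observable** `k₀ = Σ_σ (c†_{e₁σ} c_{0σ} + c†_{0σ} c_{e₁σ}) ∈ 𝔄_{[-1,1]²}`
(its translation sum is the `e₁`-kinetic operator `kinOpTT' L 0`). [cite: HazraVermaRanderia2019, eq. (4)] -/
def kinBondObs : FermionOp (box 2 1) :=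
  ∑ σ : Fin 2, ((cAt (unitVec 0) unitVec_zero_mem_box_one σ)ᴴ * cAt 0 zero_mem_box_one σ +
    (cAt 0 zero_mem_box_one σ)ᴴ * cAt (unitVec 0) unitVec_zero_mem_box_one σ)

/-- The **`e₁`-bond current observable** `j₀ = Σ_σ (−i c†_{e₁σ} c_{0σ} + i c†_{0σ} c_{e₁σ}) ∈ 𝔄_{[-1,1]²}`
(its translation sum is the current operator `curOpTT' L 0`). [cite: ScalapinoWhiteZhang1993, §II] -/
def curBondObs : FermionOp (box 2 1) :=
  ∑ σ : Fin 2, ((-Complex.I) • ((cAt (unitVec 0) unitVec_zero_mem_box_one σ)ᴴ * cAt 0 zero_mem_box_one σ) +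
    Complex.I • ((cAt 0 zero_mem_box_one σ)ᴴ * cAt (unitVec 0) unitVec_zero_mem_box_one σ))

/-- The **local derivative of the bond current**, `b₀ = [H_{[-2,2]²}, j₀] ∈ 𝔄_{[-2,2]²}` (`H_Λ` the
free-boundary Hubbard Hamiltonian of `Λ`, `t = 1`); its translation sum is `H𝒥 − 𝒥H`.
[cite: BratteliRobinsonII1997, Thm. 6.2.4] -/
def curDerivObs (U : ℝ) : FermionOp (box 2 2) :=
  (hubbardFermionInteraction 2 1 U).localHamiltonian (box 2 2) *
      fermionEmbed (PolySite.incl (box_subset_box (by norm_num))) curBondObs -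
    fermionEmbed (PolySite.incl (box_subset_box (by norm_num))) curBondObs *
      (hubbardFermionInteraction 2 1 U).localHamiltonian (box 2 2)

/-- The **second local derivative**, `c₀ = [H_{[-3,3]²}, b₀] ∈ 𝔄_{[-3,3]²}`; its translation sum is
`HB − BH`, `B = H𝒥 − 𝒥H`. [cite: BratteliRobinsonII1997, Thm. 6.2.4] -/
def curDeriv2Obs (U : ℝ) : FermionOp (box 2 3) :=
  (hubbardFermionInteraction 2 1 U).localHamiltonian (box 2 3) *
      fermionEmbed (PolySite.incl (box_subset_box (by norm_num))) (curDerivObs U) -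
    fermionEmbed (PolySite.incl (box_subset_box (by norm_num))) (curDerivObs U) *
      (hubbardFermionInteraction 2 1 U).localHamiltonian (box 2 3)

/-- The **first-moment density** `d₁ = Σ_{z ∈ [-3,3]²} [τ_z j₀, b₀] ∈ 𝔄_{[-4,4]²}`: the local density of
`[𝒥, [H,𝒥]]`, so that `m₁ = ½⟨[𝒥,[H,𝒥]]⟩ = ½ L² ×` its torus average. [cite: Lipparini2008, eq. (8.30)] -/
def firstMomentObs (U : ℝ) : FermionOp (box 2 4) :=
  commDensity (box 2 4) (box 2 3) (box_subset_box (by norm_num)) curBondObs (curDerivObs U)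

/-- The **third-moment density** `m₃' = Σ_{z ∈ [-5,5]²} [τ_z b₀, c₀] ∈ 𝔄_{[-7,7]²}`: the local density of
`[B, [H,B]]`, `B = [H,𝒥]`, so that `m₃ = −½⟨[B,[H,B]]⟩ = −½ L² ×` its torus average.
[cite: Lipparini2008, eq. (8.30)] -/
def thirdMomentObs (U : ℝ) : FermionOp (box 2 7) :=
  commDensity (box 2 7) (box 2 5) (box_subset_box (by norm_num)) (curDerivObs U) (curDeriv2Obs U)

/-- The **limit functional of the row `R-K3-TL` at fixed `λ`** on an infinite-volume state:
`F_λ(ω) = ½Re ω(k₀) + λ Re ω(d₁) − (λ²/2) Re ω(m₃')`. [cite: Lipparini2008, eq. (8.30)] -/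
def oddMomentLimitFunctional (U lam : ℝ) (ω : InfVolFermionState 2) : ℝ :=
  (ω.expect (box 2 1) kinBondObs).re / 2 + lam * (ω.expect (box 2 4) (firstMomentObs U)).re -
    lam ^ 2 / 2 * (ω.expect (box 2 7) (thirdMomentObs U)).re

/-! ### Evenness -/

/-- The bond current is an even observable. [cite: BratteliRobinsonII1997, §5.2.2] -/
theorem curBondObs_mem_carEvenSubalgebra :
    curBondObs ∈ carEvenSubalgebra (Finset.univ : Finset (Orb (PolySite (box 2 1)))) := by
  unfold curBondObs
  refine Subalgebra.sum_mem _ fun σ _ => Subalgebra.add_mem _ (Subalgebra.smul_mem _ ?_ _)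
    (Subalgebra.smul_mem _ ?_ _) <;>
  · rw [cAt, cAt, annihilation_conjTranspose]
    exact creation_mul_annihilation_mem_carEvenSubalgebra (Finset.mem_univ _) (Finset.mem_univ _)

/-- The free-boundary Hubbard Hamiltonian of a region is even. [cite: BratteliRobinsonII1997, §5.2.2] -/
theorem localHamiltonian_mem_carEvenSubalgebra {d : ℕ} (t U : ℝ) (Λ : Finset (Site d)) :
    (hubbardFermionInteraction d t U).localHamiltonian Λ ∈
      carEvenSubalgebra (Finset.univ : Finset (Orb (PolySite Λ))) := by
  rw [hubbardFermionInteraction_localHamiltonian, hamiltonian]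
  refine Subalgebra.add_mem _ (Subalgebra.smul_mem _ (Subalgebra.sum_mem _ fun x _ =>
    Subalgebra.sum_mem _ fun y _ => Subalgebra.sum_mem _ fun σ _ => ?_) _)
    (Subalgebra.smul_mem _ (Subalgebra.sum_mem _ fun x _ =>
      numberOp_mul_numberOp_mem_carEvenSubalgebra fun σ => Finset.mem_univ _) _)
  split_ifs
  · exact creation_mul_annihilation_mem_carEvenSubalgebra (Finset.mem_univ _) (Finset.mem_univ _)
  · exact Subalgebra.zero_mem _

/-- The local derivative `b₀` of the bond current is even. [cite: BratteliRobinsonII1997, §5.2.2] -/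
theorem curDerivObs_mem_carEvenSubalgebra (U : ℝ) :
    curDerivObs U ∈ carEvenSubalgebra (Finset.univ : Finset (Orb (PolySite (box 2 2)))) := by
  have hH := localHamiltonian_mem_carEvenSubalgebra (d := 2) 1 U (box 2 2)
  have hj : fermionEmbed (PolySite.incl (box_subset_box (by norm_num : 1 ≤ 2))) curBondObs ∈
      carEvenSubalgebra (Finset.univ : Finset (Orb (PolySite (box 2 2)))) :=
    carEvenSubalgebra_mono (Finset.subset_univ _)
      (fermionEmbed_mem_carEvenSubalgebra _ curBondObs_mem_carEvenSubalgebra)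
  unfold curDerivObs
  exact Subalgebra.sub_mem _ (Subalgebra.mul_mem _ hH hj) (Subalgebra.mul_mem _ hj hH)

/-! ### The kinetic and current operators as translation sums -/

section Finite

variable (L : ℕ) [NeZero L]

omit [NeZero L] in
/-- `0 mod L = 0`. [folklore] -/
private theorem proj_zero' : Torus.proj L (0 : Site 2) = 0 := by
  funext j; simp [Torus.proj]

/-- **`𝒦 = Σ_v T_v Γ(k₀)`** (`t' = 0`): the `e₁`-kinetic operator is the translation sum of the
embedded bond kinetic observable. [cite: HazraVermaRanderia2019, eq. (4)] -/
theorem kinOpTT'_zero_eq_sum_translate (h : Set.InjOn (Torus.proj (d := 2) L) ↑(box 2 1)) :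
    kinOpTT' L 0 =
      ∑ v : TorusSite 2 L, relabel (Orb.translate v) (fermionEmbed (PolySite.toTorusEmb L h) kinBondObs) := by
  unfold kinOpTT' kinBondObs
  rw [Complex.ofReal_zero, zero_smul, add_zero]
  refine Finset.sum_congr rfl fun v _ => ?_
  rw [fermionEmbed_sum, relabel_sum]
  refine Finset.sum_congr rfl fun σ _ => ?_
  rw [cAt, cAt, annihilation_conjTranspose, annihilation_conjTranspose, fermionEmbed_add, fermionEmbed_mul,
    fermionEmbed_mul, fermionEmbed_creation, fermionEmbed_annihilation, fermionEmbed_creation,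
    fermionEmbed_annihilation, PolySite.toTorusEmb_pt, PolySite.toTorusEmb_pt, proj_zero', proj_unitVec,
    relabel_add, relabel_mul, relabel_mul, relabel_translate_creation, relabel_translate_annihilation,
    relabel_translate_creation, relabel_translate_annihilation, zero_add, add_comm (Pi.single _ _) v]
  rfl

/-- **`𝒥 = Σ_v T_v Γ(j₀)`** (`t' = 0`): the `e₁`-current operator is the translation sum of the
embedded bond current observable. [cite: ScalapinoWhiteZhang1993, §II] -/
theorem curOpTT'_zero_eq_sum_translate (h : Set.InjOn (Torus.proj (d := 2) L) ↑(box 2 1)) :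
    curOpTT' L 0 =
      ∑ v : TorusSite 2 L, relabel (Orb.translate v) (fermionEmbed (PolySite.toTorusEmb L h) curBondObs) := by
  unfold curOpTT' curBondObs
  rw [Complex.ofReal_zero, zero_smul, add_zero]
  refine Finset.sum_congr rfl fun v _ => ?_
  rw [fermionEmbed_sum, relabel_sum]
  refine Finset.sum_congr rfl fun σ _ => ?_
  rw [cAt, cAt, annihilation_conjTranspose, annihilation_conjTranspose, fermionEmbed_add, fermionEmbed_smul,
    fermionEmbed_smul, fermionEmbed_mul, fermionEmbed_mul, fermionEmbed_creation, fermionEmbed_annihilation,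
    fermionEmbed_creation, fermionEmbed_annihilation, PolySite.toTorusEmb_pt, PolySite.toTorusEmb_pt,
    proj_zero', proj_unitVec, relabel_add, relabel_smul, relabel_smul, relabel_mul, relabel_mul,
    relabel_translate_creation, relabel_translate_annihilation, relabel_translate_creation,
    relabel_translate_annihilation, zero_add, add_comm (Pi.single _ _) v]
  rfl

/-! ### `B = [H, 𝒥]` and `[H, B]` as translation sums of local commutators -/

/-- **`H𝒥 − 𝒥H = Σ_v T_v Γ(b₀)`** (`L ≥ 7`): the commutator of the torus Hamiltonian with the current is
the translation sum of the embedded LOCAL commutator `b₀ = [H_{[-2,2]²}, j₀]`.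
[cite: BratteliRobinsonII1997, Thm. 6.2.4] -/
theorem hubbardTorus_commutator_curOpTT' (U : ℝ) (hL : 7 ≤ L)
    (h : Set.InjOn (Torus.proj (d := 2) L) ↑(box 2 2)) :
    hubbardTorus 2 L 1 U * curOpTT' L 0 - curOpTT' L 0 * hubbardTorus 2 L 1 U =
      ∑ v : TorusSite 2 L, relabel (Orb.translate v)
        (fermionEmbed (PolySite.toTorusEmb L h) (curDerivObs U)) := by
  have hInj : Set.InjOn (Torus.proj (d := 2) L) ↑(thicken (box 2 2) 1) :=
    injOn_proj_thicken_box_one (by omega)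
  have h12 : box 2 1 ⊆ box 2 2 := box_subset_box (by norm_num)
  have hJ : curOpTT' L 0 = ∑ v : TorusSite 2 L, relabel (Orb.translate v)
      (fermionEmbed (PolySite.toTorusEmb L (hInj.mono (by exact_mod_cast subset_thicken (box 2 2) 1)))
        (fermionEmbed (PolySite.incl h12) curBondObs)) := by
    rw [curOpTT'_zero_eq_sum_translate L (h.mono (Finset.coe_subset.2 h12))]
    refine Finset.sum_congr rfl fun v _ => ?_
    rw [fermionEmbed_toTorusEmb_incl]
  rw [hJ, hubbardTorus_commutator_sum_relabel_translate L 1 U h12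
    (fun x hx i => add_sub_unitVec_mem_box_succ hx i) hInj curBondObs]
  rfl

/-- **`HB − BH = Σ_v T_v Γ(c₀)`** with `B = H𝒥 − 𝒥H` (`L ≥ 9`): the second commutator is the
translation sum of the embedded LOCAL commutator `c₀ = [H_{[-3,3]²}, b₀]`.
[cite: BratteliRobinsonII1997, Thm. 6.2.4] -/
theorem hubbardTorus_commutator_commutator_curOpTT' (U : ℝ) (hL : 9 ≤ L)
    (h : Set.InjOn (Torus.proj (d := 2) L) ↑(box 2 3)) :
    hubbardTorus 2 L 1 U * (hubbardTorus 2 L 1 U * curOpTT' L 0 - curOpTT' L 0 * hubbardTorus 2 L 1 U) -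
        (hubbardTorus 2 L 1 U * curOpTT' L 0 - curOpTT' L 0 * hubbardTorus 2 L 1 U) * hubbardTorus 2 L 1 U =
      ∑ v : TorusSite 2 L, relabel (Orb.translate v)
        (fermionEmbed (PolySite.toTorusEmb L h) (curDeriv2Obs U)) := by
  have hInj : Set.InjOn (Torus.proj (d := 2) L) ↑(thicken (box 2 3) 1) :=
    injOn_proj_thicken_box_one (by omega)
  have h23 : box 2 2 ⊆ box 2 3 := box_subset_box (by norm_num)
  have hB : hubbardTorus 2 L 1 U * curOpTT' L 0 - curOpTT' L 0 * hubbardTorus 2 L 1 U =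
      ∑ v : TorusSite 2 L, relabel (Orb.translate v)
        (fermionEmbed (PolySite.toTorusEmb L (hInj.mono (by exact_mod_cast subset_thicken (box 2 3) 1)))
          (fermionEmbed (PolySite.incl h23) (curDerivObs U))) := by
    rw [hubbardTorus_commutator_curOpTT' L U (by omega) (h.mono (Finset.coe_subset.2 h23))]
    refine Finset.sum_congr rfl fun v _ => ?_
    rw [fermionEmbed_toTorusEmb_incl]
  rw [hB, hubbardTorus_commutator_sum_relabel_translate L 1 U h23
    (fun x hx i => add_sub_unitVec_mem_box_succ hx i) hInj (curDerivObs U)]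
  rfl

/-! ### `Re⟨ψ, XY ψ⟩ = ½ Re⟨ψ, [X,Y] ψ⟩` when `(XY)⋆ = −YX` -/

/-- If `(XY)⋆ = −YX` (e.g. `X` Hermitian and `Y` anti-Hermitian, or vice versa), then
`Re⟨ψ, XYψ⟩ = ½ Re⟨ψ, (XY − YX)ψ⟩` (`⟨ψ, YXψ⟩ = −conj⟨ψ, XYψ⟩`). [folklore] -/
theorem re_star_dotProduct_mul_mulVec_eq_half {n : Type*} [Fintype n] [DecidableEq n]
    (X Y : Matrix n n ℂ) (hXY : (X * Y)ᴴ = -(Y * X)) (ψ : n → ℂ) :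
    (star ψ ⬝ᵥ ((X * Y) *ᵥ ψ)).re = (star ψ ⬝ᵥ ((X * Y - Y * X) *ᵥ ψ)).re / 2 := by
  have h1 : star ((X * Y) *ᵥ ψ) ⬝ᵥ ψ = star (star ψ ⬝ᵥ ((X * Y) *ᵥ ψ)) := Matrix.star_dotProduct _ _
  rw [star_mulVec, ← dotProduct_mulVec, hXY, Matrix.neg_mulVec, dotProduct_neg] at h1
  have h2 : star ψ ⬝ᵥ ((Y * X) *ᵥ ψ) = -star (star ψ ⬝ᵥ ((X * Y) *ᵥ ψ)) := neg_eq_iff_eq_neg.1 h1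
  rw [sub_mulVec, dotProduct_sub, Complex.sub_re, h2, Complex.neg_re, Complex.star_def, Complex.conj_re]
  ring

/-! ### Anti-Hermiticity of `B = H𝒥 − 𝒥H` -/

/-- Anti-Hermiticity of `B = H𝒥 − 𝒥H`: `Bᴴ = −B`. [folklore] -/
theorem conjTranspose_commutator_curOpTT' (U : ℝ) :
    (hubbardTorus 2 L 1 U * curOpTT' L 0 - curOpTT' L 0 * hubbardTorus 2 L 1 U)ᴴ =
      -(hubbardTorus 2 L 1 U * curOpTT' L 0 - curOpTT' L 0 * hubbardTorus 2 L 1 U) := by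
  have hH : (hubbardTorus 2 L 1 U)ᴴ = hubbardTorus 2 L 1 U :=
    (hamiltonian_isHermitian_and_commute_holds (fermionTorusGraph 2 L) 1 U).1
  have hJ : (curOpTT' L 0)ᴴ = curOpTT' L 0 := (isHermitian_curOpTT' (L := L) 0).eq
  rw [conjTranspose_sub, conjTranspose_mul, conjTranspose_mul, hH, hJ, neg_sub]

end Finite

end Summit.Ventures.CertifiedManyBodySolver.Observables

end
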